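import Summits.BirchSwinnertonDyer.BirchSwinnertonDyer.Theorems.Rank2ObservatoryTorsionCertA
import HarnessLib

/-!
# Rank-2 observatory — torsion certificates, part B: split 2-torsion and first order theorems

HONEST FRAMING: per-curve certified theorems and census instruments; no claim on BSD in rank ≥ 2.

This part: the explicit `2`-torsion of an integral model whose `2`-division cubic splits over `ℤ`
(`twoSplitB`), the `2`-power descent `2^(e+1) • τ = 0 → 2 • τ = 0`, and the order theorems
`#E(ℚ)_tors = 1` (killers only / killers + 3-isogeny data) and `#E(ℚ)_tors = 3`.
-/

-- single-conjunct summit: `Summit.BirchSwinnertonDyer.BirchSwinnertonDyer.…` repeats the name by design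
set_option linter.dupNamespace false

namespace Summit.BirchSwinnertonDyer.BirchSwinnertonDyer.Rank2Observatory

open WeierstrassCurve Literature.NumberTheory.EllipticCurves

section IntModel

variable (V : WeierstrassCurve ℤ)

/-! #### Split `2`-torsion -/

/-- Boolean: `(xᵢ, yᵢ)` (`i = 1,2,3`) have vertical tangents, the `2`-division cubic
`4X³ + b₂X² + 2b₄X + b₆` is `4(X − x₁)(X − x₂)(X − x₃)`, and the `xᵢ` are distinct. [folklore] -/
def twoSplitB (x₁ y₁ x₂ y₂ x₃ y₃ : ℤ) : Bool :=
  decide (2 * y₁ + V.a₁ * x₁ + V.a₃ = 0 ∧ 2 * y₂ + V.a₁ * x₂ + V.a₃ = 0 ∧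
    2 * y₃ + V.a₁ * x₃ + V.a₃ = 0 ∧ V.b₂ = -4 * (x₁ + x₂ + x₃) ∧
    2 * V.b₄ = 4 * (x₁ * x₂ + x₁ * x₃ + x₂ * x₃) ∧ V.b₆ = -4 * (x₁ * x₂ * x₃) ∧
    x₁ ≠ x₂ ∧ x₁ ≠ x₃ ∧ x₂ ≠ x₃)

/-- **Split `2`-torsion**: if the `2`-division cubic splits as `4(X − x₁)(X − x₂)(X − x₃)` with
`Tᵢ = (xᵢ, yᵢ)` on the curve with vertical tangents, every `τ` with `2 • τ = 0` is `𝒪` or some `Tᵢ`.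
[cite: SilvermanAEC2009, III.2.3(a)] -/
theorem eq_of_two_nsmul_eq_zero_of_split (hΔ : V.Δ ≠ 0) {x₁ y₁ x₂ y₂ x₃ y₃ : ℤ}
    (h₁ : y₁ ^ 2 + V.a₁ * x₁ * y₁ + V.a₃ * y₁ = x₁ ^ 3 + V.a₂ * x₁ ^ 2 + V.a₄ * x₁ + V.a₆)
    (h₂ : y₂ ^ 2 + V.a₁ * x₂ * y₂ + V.a₃ * y₂ = x₂ ^ 3 + V.a₂ * x₂ ^ 2 + V.a₄ * x₂ + V.a₆)
    (h₃ : y₃ ^ 2 + V.a₁ * x₃ * y₃ + V.a₃ * y₃ = x₃ ^ 3 + V.a₂ * x₃ ^ 2 + V.a₄ * x₃ + V.a₆)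
    (hs : twoSplitB V x₁ y₁ x₂ y₂ x₃ y₃ = true)
    (τ : (V.map (Int.castRingHom ℚ)).toAffine.Point) (hτ : 2 • τ = 0) :
    τ = 0 ∨ τ = .some (x₁ : ℚ) (y₁ : ℚ) (nonsingular_rat_of_eq V hΔ h₁) ∨
      τ = .some (x₂ : ℚ) (y₂ : ℚ) (nonsingular_rat_of_eq V hΔ h₂) ∨
      τ = .some (x₃ : ℚ) (y₃ : ℚ) (nonsingular_rat_of_eq V hΔ h₃) := by
  simp only [twoSplitB, decide_eq_true_eq] at hs
  obtain ⟨hd₁, hd₂, hd₃, hb₂, hb₄, hb₆, -, -, -⟩ := hs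
  cases τ with
  | zero => exact Or.inl rfl
  | @some u v hns =>
    right
    have heq := equation_rat_of_nonsingular V hns
    have hd := two_y_eq_of_two_nsmul_eq_zero hns hτ
    have ha₁ : (V.map (Int.castRingHom ℚ)).a₁ = (V.a₁ : ℚ) := by simp [WeierstrassCurve.map]
    have ha₃ : (V.map (Int.castRingHom ℚ)).a₃ = (V.a₃ : ℚ) := by simp [WeierstrassCurve.map]
    rw [ha₁, ha₃] at hd
    -- the 2-division cubic vanishes at `u`
    have hb₂' : (V.b₂ : ℚ) = -4 * (x₁ + x₂ + x₃) := by exact_mod_cast hb₂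
    have hb₄' : 2 * (V.b₄ : ℚ) = 4 * (x₁ * x₂ + x₁ * x₃ + x₂ * x₃) := by exact_mod_cast hb₄
    have hb₆' : (V.b₆ : ℚ) = -4 * (x₁ * x₂ * x₃) := by exact_mod_cast hb₆
    have hB₂ : (V.b₂ : ℚ) = V.a₁ ^ 2 + 4 * V.a₂ := by
      have : V.b₂ = V.a₁ ^ 2 + 4 * V.a₂ := rfl
      exact_mod_cast this
    have hB₄ : (V.b₄ : ℚ) = 2 * V.a₄ + V.a₁ * V.a₃ := by
      have : V.b₄ = 2 * V.a₄ + V.a₁ * V.a₃ := rfl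
      exact_mod_cast this
    have hB₆ : (V.b₆ : ℚ) = V.a₃ ^ 2 + 4 * V.a₆ := by
      have : V.b₆ = V.a₃ ^ 2 + 4 * V.a₆ := rfl
      exact_mod_cast this
    have hcubic : 4 * (u - x₁) * (u - x₂) * (u - x₃) = 0 := by
      linear_combination (2 * v + (V.a₁ : ℚ) * u + V.a₃) * hd - 4 * heq - u ^ 2 * hb₂'
        - u * hb₄' - hb₆' + u ^ 2 * hB₂ + 2 * u * hB₄ + hB₆
    have hd₁' : 2 * (y₁ : ℚ) + V.a₁ * x₁ + V.a₃ = 0 := by exact_mod_cast hd₁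
    have hd₂' : 2 * (y₂ : ℚ) + V.a₁ * x₂ + V.a₃ = 0 := by exact_mod_cast hd₂
    have hd₃' : 2 * (y₃ : ℚ) + V.a₁ * x₃ + V.a₃ = 0 := by exact_mod_cast hd₃
    rcases mul_eq_zero.mp hcubic with h12 | hu3
    · rcases mul_eq_zero.mp h12 with h1 | hu2
      · rcases mul_eq_zero.mp h1 with h4 | hu1
        · norm_num at h4
        · left
          have hu : u = x₁ := by linear_combination hu1
          subst hu
          have hv : v = y₁ := by linear_combination (hd - hd₁') / 2
          subst hv; rfl
      · right; left
        have hu : u = x₂ := by linear_combination hu2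
        subst hu
        have hv : v = y₂ := by linear_combination (hd - hd₂') / 2
        subst hv; rfl
    · right; right
      have hu : u = x₃ := by linear_combination hu3
      subst hu
      have hv : v = y₃ := by linear_combination (hd - hd₃') / 2
      subst hv; rfl

open scoped Classical in
/-- **No rational point doubles to `Tᵢ`** (`i = 1,2,3`) when each `xᵢ` is double-free modulo some good
prime: then every rational `w` with `4 • w = 0` has `2 • w = 0`. [cite: SilvermanAEC2009, VII.3.1(b)] -/
theorem two_nsmul_eq_zero_of_four_nsmul_of_split {x₁ y₁ x₂ y₂ x₃ y₃ : ℤ}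
    (h₁ : y₁ ^ 2 + V.a₁ * x₁ * y₁ + V.a₃ * y₁ = x₁ ^ 3 + V.a₂ * x₁ ^ 2 + V.a₄ * x₁ + V.a₆)
    (h₂ : y₂ ^ 2 + V.a₁ * x₂ * y₂ + V.a₃ * y₂ = x₂ ^ 3 + V.a₂ * x₂ ^ 2 + V.a₄ * x₂ + V.a₆)
    (h₃ : y₃ ^ 2 + V.a₁ * x₃ * y₃ + V.a₃ * y₃ = x₃ ^ 3 + V.a₂ * x₃ ^ 2 + V.a₄ * x₃ + V.a₆)
    (hs : twoSplitB V x₁ y₁ x₂ y₂ x₃ y₃ = true)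
    (q₁ : ℕ) [Fact (Nat.Prime q₁)] (hq₁ : ¬ (q₁ : ℤ) ∣ V.Δ) (hf₁ : xDoubleFree V q₁ (x₁ : ZMod q₁) = true)
    (q₂ : ℕ) [Fact (Nat.Prime q₂)] (hq₂ : ¬ (q₂ : ℤ) ∣ V.Δ) (hf₂ : xDoubleFree V q₂ (x₂ : ZMod q₂) = true)
    (q₃ : ℕ) [Fact (Nat.Prime q₃)] (hq₃ : ¬ (q₃ : ℤ) ∣ V.Δ) (hf₃ : xDoubleFree V q₃ (x₃ : ZMod q₃) = true)
    (w : (V.map (Int.castRingHom ℚ)).toAffine.Point) (hw : 4 • w = 0) : 2 • w = 0 := by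
  have hΔ : V.Δ ≠ 0 := Δ_ne_zero_of_not_dvd V hq₁
  have h4 : 2 • (2 • w) = 0 := by rw [← mul_nsmul]; exact hw
  have e₁ : V.toAffine.Equation x₁ y₁ := (Affine.equation_iff _ _).mpr h₁
  have e₂ : V.toAffine.Equation x₂ y₂ := (Affine.equation_iff _ _).mpr h₂
  have e₃ : V.toAffine.Equation x₃ y₃ := (Affine.equation_iff _ _).mpr h₃
  -- generic contradiction: `2 • w = Tᵢ` is impossible when `xᵢ` is double-free mod `qᵢ`
  have key : ∀ (q : ℕ) [Fact (Nat.Prime q)] (hq : ¬ (q : ℤ) ∣ V.Δ) {X Y : ℤ}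
      (e : V.toAffine.Equation X Y) (hf : xDoubleFree V q (X : ZMod q) = true)
      (hns : (V.map (Int.castRingHom ℚ)).toAffine.Nonsingular (X : ℚ) (Y : ℚ)),
      2 • w ≠ .some (X : ℚ) (Y : ℚ) hns := by
    intro q _ hq X Y e hf hns hwT
    have hmem : (Affine.Point.some (X : ZMod q) (Y : ZMod q) (nonsingular_zmod_of_equation V q hq e) :
        (V.map (Int.castRingHom (ZMod q))).toAffine.Point) ∈
        twoCoset (V.map (Int.castRingHom (ZMod q))).toAffine.Point 0 := by
      refine ⟨reduceMod V q hq w, 0, by simp, ?_⟩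
      rw [two_zsmul, add_zero, ← two_nsmul, ← map_nsmul, hwT, reduceMod_some V q hq e]
    exact not_mem_twoCoset_of_xDoubleFree V q hf _ hmem
  rcases eq_of_two_nsmul_eq_zero_of_split V hΔ h₁ h₂ h₃ hs (2 • w) h4 with h | h | h | h
  · exact h
  · exact absurd h (key q₁ hq₁ e₁ hf₁ _)
  · exact absurd h (key q₂ hq₂ e₂ hf₂ _)
  · exact absurd h (key q₃ hq₃ e₃ hf₃ _)

/-- Descent `2^e → 2`: if `4 • w = 0 → 2 • w = 0` for all `w`, then `2^(e+1) • x = 0 → 2 • x = 0`.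
[folklore] -/
theorem two_nsmul_eq_zero_of_pow {A : Type*} [AddCommGroup A]
    (h : ∀ w : A, 4 • w = 0 → 2 • w = 0) :
    ∀ (e : ℕ) (x : A), 2 ^ (e + 1) • x = 0 → 2 • x = 0 := by
  intro e
  induction e with
  | zero => intro x hx; simpa using hx
  | succ e ih =>
    intro x hx
    have h1 : 2 ^ (e + 1) • (2 • x) = 0 := by
      rw [← mul_nsmul, show 2 * 2 ^ (e + 1) = 2 ^ (e + 1 + 1) by ring]; exact hx
    have h2 : 2 • (2 • x) = 0 := ih (2 • x) h1
    exact h x (by rw [show (4 : ℕ) = 2 * 2 from rfl, mul_nsmul]; exact h2)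

end IntModel

/-! ### Orders of the torsion subgroup from certificates -/

section Orders

variable (V : WeierstrassCurve ℤ)

/-- `(2 : ℤ) • a = 0 ↔ 2 • a = 0`. [folklore] -/
theorem two_zsmul_eq_zero_iff {A : Type*} [AddCommGroup A] (a : A) :
    (2 : ℤ) • a = 0 ↔ 2 • a = 0 := by
  rw [show (2 : ℤ) = ((2 : ℕ) : ℤ) from rfl, natCast_zsmul]

/-- `(2 : ℤ) ^ 2 • a = 0 ↔ 4 • a = 0`. [folklore] -/
theorem two_sq_zsmul_eq_zero_iff {A : Type*} [AddCommGroup A] (a : A) :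
    (2 : ℤ) ^ 2 • a = 0 ↔ 4 • a = 0 := by
  rw [show (2 : ℤ) ^ 2 = ((4 : ℕ) : ℤ) by norm_num, natCast_zsmul]

/-- Two integral points with distinct abscissae are distinct rational points. [folklore] -/
theorem some_ne_some_of_ne {X Y X' Y' : ℤ} (hX : X ≠ X')
    (h : (V.map (Int.castRingHom ℚ)).toAffine.Nonsingular (X : ℚ) (Y : ℚ))
    (h' : (V.map (Int.castRingHom ℚ)).toAffine.Nonsingular (X' : ℚ) (Y' : ℚ)) :
    (Affine.Point.some (X : ℚ) (Y : ℚ) h : (V.map (Int.castRingHom ℚ)).toAffine.Point) ≠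
      .some (X' : ℚ) (Y' : ℚ) h' := by
  intro heq
  rw [Affine.Point.some.injEq] at heq
  exact hX (by exact_mod_cast heq.1)

/-- **Trivial torsion**: killers with annihilator `t = 1` give `#E(ℚ)_tors = 1`.
[cite: SilvermanAEC2009, Prop. VII.3.1(b)] -/
theorem torsionOrder_eq_one_of_killers {S : List (ℕ × ℕ)} (hS : S.all (killerB V) = true)
    (ht : annihilatorCheck S 1 = true) : (V.map (Int.castRingHom ℚ)).torsionOrder = 1 := by
  have h1 : ∀ τ : (V.map (Int.castRingHom ℚ)).toAffine.Point, IsOfFinAddOrder τ → τ = 0 :=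
    fun τ hτ => by
      simpa using nsmul_eq_zero_of_annihilatorCheck (killers_of_all_killerB V hS) ht hτ
  rw [torsionOrder_eq_card _ {0} (fun τ => ⟨fun hτ => by simp [h1 τ hτ], fun hτ => by
      rw [Finset.mem_singleton] at hτ; rw [hτ]; exact IsOfFinAddOrder.zero⟩)]
  exact Finset.card_singleton _

/-- **Trivial torsion, `3`-isogenous case**: killers with annihilator `t = 3` and no rational
`3`-torsion (`eq_zero_of_three_nsmul_eq_zero`) give `#E(ℚ)_tors = 1`.
[cite: SilvermanAEC2009, Prop. VII.3.1(b) and III Exercise 3.7] -/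
theorem torsionOrder_eq_one_of_isog {S : List (ℕ × ℕ)} (hS : S.all (killerB V) = true)
    (ht : annihilatorCheck S 3 = true) {p₀ q₀ c₃ c₂ c₁ c₀ : ℤ} {m m' : ℕ}
    (hfac : psi3FactorB V p₀ q₀ c₃ c₂ c₁ c₀ = true) (hc : noRatRootB c₃ c₂ c₁ c₀ m = true)
    (hD : nonSquareB (threeDiscZ V p₀ q₀) m' = true) :
    (V.map (Int.castRingHom ℚ)).torsionOrder = 1 := by
  have h1 : ∀ τ : (V.map (Int.castRingHom ℚ)).toAffine.Point, IsOfFinAddOrder τ → τ = 0 :=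
    fun τ hτ => eq_zero_of_three_nsmul_eq_zero V hfac hc hD τ
      (nsmul_eq_zero_of_annihilatorCheck (killers_of_all_killerB V hS) ht hτ)
  rw [torsionOrder_eq_card _ {0} (fun τ => ⟨fun hτ => by simp [h1 τ hτ], fun hτ => by
      rw [Finset.mem_singleton] at hτ; rw [hτ]; exact IsOfFinAddOrder.zero⟩)]
  exact Finset.card_singleton _

/-- **`E(ℚ)_tors ≅ ℤ/3`**: killers with annihilator `t = 3`, an integral point `P₀ = (x₀, y₀)` with
`2P₀ = −P₀` (`intTangent`) and `ψ₃ = (X − x₀)·c` with `c` free of rational roots give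
`#E(ℚ)_tors = 3`. [cite: SilvermanAEC2009, Prop. VII.3.1(b) and III Exercise 3.7] -/
theorem torsionOrder_eq_three_of_witness (hΔ : V.Δ ≠ 0) {S : List (ℕ × ℕ)}
    (hS : S.all (killerB V) = true) (ht : annihilatorCheck S 3 = true) {x₀ y₀ : ℤ}
    (h₀ : y₀ ^ 2 + V.a₁ * x₀ * y₀ + V.a₃ * y₀ = x₀ ^ 3 + V.a₂ * x₀ ^ 2 + V.a₄ * x₀ + V.a₆)
    (htan : intTangent V x₀ y₀ x₀ (-y₀ - V.a₁ * x₀ - V.a₃) = true)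
    {c₃ c₂ c₁ c₀ : ℤ} {m : ℕ} (hfac : psi3FactorB V x₀ 1 c₃ c₂ c₁ c₀ = true)
    (hc : noRatRootB c₃ c₂ c₁ c₀ m = true) :
    (V.map (Int.castRingHom ℚ)).torsionOrder = 3 := by
  set P₀ : (V.map (Int.castRingHom ℚ)).toAffine.Point :=
    .some (x₀ : ℚ) (y₀ : ℚ) (nonsingular_rat_of_eq V hΔ h₀) with hP₀
  have hneg : (-y₀ - V.a₁ * x₀ - V.a₃) ^ 2 + V.a₁ * x₀ * (-y₀ - V.a₁ * x₀ - V.a₃) +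
      V.a₃ * (-y₀ - V.a₁ * x₀ - V.a₃) = x₀ ^ 3 + V.a₂ * x₀ ^ 2 + V.a₄ * x₀ + V.a₆ := by
    linear_combination h₀
  have hdbl := some_add_self_of_intTangent V hΔ h₀ hneg htan
  have hnegP : -P₀ = .some ((x₀ : ℤ) : ℚ) ((-y₀ - V.a₁ * x₀ - V.a₃ : ℤ) : ℚ)
      (nonsingular_rat_of_eq V hΔ hneg) := by
    rw [hP₀, Affine.Point.neg_some]
    congr 1
    simp only [Affine.negY, WeierstrassCurve.map, eq_intCast]
    push_cast; ring
  have hP3 : P₀ + P₀ = -P₀ := by rw [hnegP]; exact hdbl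
  have hP3' : 3 • P₀ = 0 := (three_nsmul_eq_zero_iff P₀).mpr hP3
  have hPfin : IsOfFinAddOrder P₀ := isOfFinAddOrder_iff_nsmul_eq_zero.mpr ⟨3, by norm_num, hP3'⟩
  obtain ⟨hd0, -⟩ := qX_eq_of_add_self_eq_neg V hfac hc _ hP3
  have hP0 : P₀ ≠ 0 := Affine.Point.some_ne_zero _
  have hPneg : P₀ ≠ -P₀ := by
    intro h
    rw [hP₀, Affine.Point.neg_some, Affine.Point.some.injEq] at h
    obtain ⟨-, hy⟩ := h
    simp [Affine.negY, WeierstrassCurve.map] at hy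
    exact hd0 (by linear_combination hy)
  have h3 : ∀ τ : (V.map (Int.castRingHom ℚ)).toAffine.Point, IsOfFinAddOrder τ → 3 • τ = 0 :=
    fun τ hτ => nsmul_eq_zero_of_annihilatorCheck (killers_of_all_killerB V hS) ht hτ
  rw [torsionOrder_eq_card _ {0, P₀, -P₀} ?_]
  · exact Finset.card_eq_three.mpr ⟨0, P₀, -P₀, hP0.symm, fun h => hP0 (neg_eq_zero.mp h.symm),
      hPneg, rfl⟩
  · intro τ
    constructor
    · intro hτ
      rcases eq_of_three_nsmul_eq_zero V hΔ h₀ hfac hc τ (h3 τ hτ) with h | h | h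
      · rw [h]; exact Finset.mem_insert_self _ _
      · rw [h]; exact Finset.mem_insert_of_mem (Finset.mem_insert_self _ _)
      · rw [h]
        exact Finset.mem_insert_of_mem (Finset.mem_insert_of_mem (Finset.mem_singleton_self _))
    · intro hτ
      rcases Finset.mem_insert.mp hτ with h | h
      · rw [h]; exact IsOfFinAddOrder.zero
      rcases Finset.mem_insert.mp h with h | h
      · rw [h]; exact hPfin
      · rw [Finset.mem_singleton.mp h]; exact hPfin.neg

end Orders

end Summit.BirchSwinnertonDyer.BirchSwinnertonDyer.Rank2Observatory
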